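import Mathlib
import Summits.Ventures.PercRepro2.HCov
import Summits.Ventures.PercRepro2.CCTRootEdge
import Summits.Ventures.PercRepro2.A3RootEdge
import Summits.Ventures.PercRepro2.EdgeCubic

/-!
# The a₃–o edges: `Gc` vanishes at the pinned instance, and the o-edge closure from the two
Bernstein coefficients (blind cell PercRepro2, p5 g14; `proofs/P5-OEDGE.md` §2)

For an edge `e = {a₃, o}` (`hends : ends e = s(a₃, o)`) the pinned instance `p[e↦1]` has `a₃ ≡ o`:
the worlds `PD ∩ {o ∈ U}` are null, `Q ∩ {o ∈ C_i} = T′ / T`, and every `σ_o`-moment collapses to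
the corresponding `σ₃`-moment (`prob_one_PD_oL_inter`, `prob_one_Q_oL_inter`, …), so
**`Gc_update_one_eq_zero`**: `Gc p[e↦1] = 0` (the edge form of `Gc_a3_eq_o`), and with the one-edge
cubic `Gc_pin_cubic` of EdgeCubic.lean the closure **`HCov_of_update_zero_of_bern_o`** needs only
`HCov p[e↦0]`, `0 ≤ B1` and `0 ≤ B2`: the o-edge closure «(HCOV) on `G − e` ⟹ (HCOV) on `G`» for
every weight of `e` FOLLOWS FROM the two t-free inequalities `P1 ≥ 0`, `P2 ≥ 0` of P5-OEDGE.md §2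
(`B1 = Q₀²Q₁[(α + α′)G₀ + P1]`, `B2 = Q₀Q₁²[α′G₀ + P2]`, so `0 ≤ B1`, `0 ≤ B2` hold whenever
`HCov p[e↦0]`, `P1 ≥ 0` and `P2 ≥ 0` do), whose proof is the open content of the next edge class
after the root edges (A3RootEdgeAll: `HCov_all_iff_noRootEdge_all`).
-/

namespace Summit.Ventures.PercRepro2

open UnionCluster

namespace CovForm

/-! ## The a₃–o edges: the pinned instance `p[e↦1]` has `a₃ ≡ o` -/

namespace OEdge

open CCT RootEdge EdgeLine

section Pinned

variable {V : Type*} {E : Type*} [Fintype E] [DecidableEq E] {R : Type*} [Field R] [LinearOrder R]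

variable {ends : E → Sym2 V} {e : E} {o a₃ : V}

omit [Fintype E] in
/-- With `e = {a₃, o}` open, `a₃ ↔ o`. -/
lemma conn_update_true_o (hends : ends e = s(a₃, o)) (ω : Config E) :
    Conn ends (Function.update ω e true) a₃ o :=
  conn_update_true (a₁ := a₃) (a₃ := o) hends ω

omit [LinearOrder R] in
/-- At `p[e↦1]`, `PD ∩ {o ∈ C₁}` is null (`o ↔ a₃`, so `o ∈ U` forces `a₃ ∈ U`). -/
lemma prob_one_PD_oL_inter (p : E → R) (hends : ends e = s(a₃, o)) (a₁ a₂ : V)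
    (X : Set (Config E)) :
    prob (Function.update p e 1) (PDEvent ends a₁ a₂ a₃ ∩ (connEvent ends a₁ o ∩ X)) = 0 := by
  rw [prob_update_one_eq]
  have h : {ω : Config E | Function.update ω e true ∈
      PDEvent ends a₁ a₂ a₃ ∩ (connEvent ends a₁ o ∩ X)} = ∅ := by
    ext ω
    simp only [Set.mem_setOf_eq, Set.mem_empty_iff_false, iff_false, Set.mem_inter_iff, not_and]
    intro hPD h1o _
    have h3o := conn_update_true_o hends ω
    simp only [PDEvent, Dtilde, Set.mem_inter_iff, Set.mem_compl_iff, mem_inU] at hPD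
    exact hPD.2 (Or.inl (conn_trans h3o (conn_symm h1o)))
  rw [h, prob_empty]

omit [LinearOrder R] in
/-- At `p[e↦1]`, `PD ∩ {o ∈ C₂}` is null. -/
lemma prob_one_PD_oH_inter (p : E → R) (hends : ends e = s(a₃, o)) (a₁ a₂ : V)
    (X : Set (Config E)) :
    prob (Function.update p e 1) (PDEvent ends a₁ a₂ a₃ ∩ (connEvent ends a₂ o ∩ X)) = 0 := by
  rw [prob_update_one_eq]
  have h : {ω : Config E | Function.update ω e true ∈
      PDEvent ends a₁ a₂ a₃ ∩ (connEvent ends a₂ o ∩ X)} = ∅ := by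
    ext ω
    simp only [Set.mem_setOf_eq, Set.mem_empty_iff_false, iff_false, Set.mem_inter_iff, not_and]
    intro hPD h2o _
    have h3o := conn_update_true_o hends ω
    simp only [PDEvent, Dtilde, Set.mem_inter_iff, Set.mem_compl_iff, mem_inU] at hPD
    exact hPD.2 (Or.inr (conn_trans h3o (conn_symm h2o)))
  rw [h, prob_empty]

omit [LinearOrder R] in
/-- At `p[e↦1]`, `Q ∩ {o ∈ C₁} = T′` (`= Q ∩ {a₃ ∈ C₁}`). -/
lemma prob_one_Q_oL_inter (p : E → R) (hends : ends e = s(a₃, o)) (a₁ a₂ : V)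
    (X : Set (Config E)) :
    prob (Function.update p e 1) (avoidAll ends a₂ {a₁} ∩ (connEvent ends a₁ o ∩ X)) =
      prob (Function.update p e 1) (TEvent ends a₂ a₁ a₃ ∩ X) := by
  rw [prob_update_one_eq, prob_update_one_eq]
  congr 1
  ext ω
  have h3o := conn_update_true_o hends ω
  simp only [Set.mem_setOf_eq, Set.mem_inter_iff, TEvent, Set.mem_compl_iff, mem_connEvent,
    mem_avoidAll, Finset.mem_singleton, forall_eq]
  constructor
  · rintro ⟨hQ, h1o, hX⟩
    exact ⟨⟨fun hc => hQ (conn_symm hc), conn_trans h1o (conn_symm h3o)⟩, hX⟩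
  · rintro ⟨⟨hQ, h13⟩, hX⟩
    exact ⟨fun hc => hQ (conn_symm hc), conn_trans h13 h3o, hX⟩

omit [LinearOrder R] in
/-- At `p[e↦1]`, `Q ∩ {o ∈ C₂} = T` (`= Q ∩ {a₃ ∈ C₂}`). -/
lemma prob_one_Q_oH_inter (p : E → R) (hends : ends e = s(a₃, o)) (a₁ a₂ : V)
    (X : Set (Config E)) :
    prob (Function.update p e 1) (avoidAll ends a₂ {a₁} ∩ (connEvent ends a₂ o ∩ X)) =
      prob (Function.update p e 1) (TEvent ends a₁ a₂ a₃ ∩ X) := by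
  rw [prob_update_one_eq, prob_update_one_eq]
  congr 1
  ext ω
  have h3o := conn_update_true_o hends ω
  simp only [Set.mem_setOf_eq, Set.mem_inter_iff, TEvent, Set.mem_compl_iff, mem_connEvent,
    mem_avoidAll, Finset.mem_singleton, forall_eq]
  constructor
  · rintro ⟨hQ, h2o, hX⟩
    exact ⟨⟨hQ, conn_trans h2o (conn_symm h3o)⟩, hX⟩
  · rintro ⟨⟨hQ, h23⟩, hX⟩
    exact ⟨hQ, conn_trans h23 h3o, hX⟩

omit [LinearOrder R] in
/-- At `p[e↦1]`, `T′ ∩ {o ∈ C₁} = T′`. -/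
lemma prob_one_T'_oL_inter (p : E → R) (hends : ends e = s(a₃, o)) (a₁ a₂ : V)
    (X : Set (Config E)) :
    prob (Function.update p e 1) (TEvent ends a₂ a₁ a₃ ∩ (connEvent ends a₁ o ∩ X)) =
      prob (Function.update p e 1) (TEvent ends a₂ a₁ a₃ ∩ X) := by
  rw [prob_update_one_eq, prob_update_one_eq]
  congr 1
  ext ω
  have h3o := conn_update_true_o hends ω
  simp only [Set.mem_setOf_eq, Set.mem_inter_iff, TEvent, Set.mem_compl_iff, mem_connEvent]
  constructor
  · rintro ⟨hT, _, hX⟩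
    exact ⟨hT, hX⟩
  · rintro ⟨hT, hX⟩
    exact ⟨hT, conn_trans hT.2 h3o, hX⟩

omit [LinearOrder R] in
/-- At `p[e↦1]`, `T′ ∩ {o ∈ C₂}` is null (`o ↔ a₃ ↔ a₁` would join the roots). -/
lemma prob_one_T'_oH_inter (p : E → R) (hends : ends e = s(a₃, o)) (a₁ a₂ : V)
    (X : Set (Config E)) :
    prob (Function.update p e 1) (TEvent ends a₂ a₁ a₃ ∩ (connEvent ends a₂ o ∩ X)) = 0 := by
  rw [prob_update_one_eq]
  have h : {ω : Config E | Function.update ω e true ∈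
      TEvent ends a₂ a₁ a₃ ∩ (connEvent ends a₂ o ∩ X)} = ∅ := by
    ext ω
    simp only [Set.mem_setOf_eq, Set.mem_empty_iff_false, iff_false, Set.mem_inter_iff, not_and]
    intro hT h2o _
    have h3o := conn_update_true_o hends ω
    simp only [TEvent, Set.mem_inter_iff, Set.mem_compl_iff, mem_connEvent] at hT
    exact hT.1 (conn_trans (conn_trans hT.2 h3o) (conn_symm h2o))
  rw [h, prob_empty]

omit [LinearOrder R] in
/-- At `p[e↦1]`, `T ∩ {o ∈ C₂} = T`. -/
lemma prob_one_T_oH_inter (p : E → R) (hends : ends e = s(a₃, o)) (a₁ a₂ : V)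
    (X : Set (Config E)) :
    prob (Function.update p e 1) (TEvent ends a₁ a₂ a₃ ∩ (connEvent ends a₂ o ∩ X)) =
      prob (Function.update p e 1) (TEvent ends a₁ a₂ a₃ ∩ X) := by
  rw [prob_update_one_eq, prob_update_one_eq]
  congr 1
  ext ω
  have h3o := conn_update_true_o hends ω
  simp only [Set.mem_setOf_eq, Set.mem_inter_iff, TEvent, Set.mem_compl_iff, mem_connEvent]
  constructor
  · rintro ⟨hT, _, hX⟩
    exact ⟨hT, hX⟩
  · rintro ⟨hT, hX⟩
    exact ⟨hT, conn_trans hT.2 h3o, hX⟩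

omit [LinearOrder R] in
/-- At `p[e↦1]`, `T ∩ {o ∈ C₁}` is null. -/
lemma prob_one_T_oL_inter (p : E → R) (hends : ends e = s(a₃, o)) (a₁ a₂ : V)
    (X : Set (Config E)) :
    prob (Function.update p e 1) (TEvent ends a₁ a₂ a₃ ∩ (connEvent ends a₁ o ∩ X)) = 0 := by
  rw [prob_update_one_eq]
  have h : {ω : Config E | Function.update ω e true ∈
      TEvent ends a₁ a₂ a₃ ∩ (connEvent ends a₁ o ∩ X)} = ∅ := by
    ext ω
    simp only [Set.mem_setOf_eq, Set.mem_empty_iff_false, iff_false, Set.mem_inter_iff, not_and]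
    intro hT h1o _
    have h3o := conn_update_true_o hends ω
    simp only [TEvent, Set.mem_inter_iff, Set.mem_compl_iff, mem_connEvent] at hT
    exact hT.1 (conn_trans (conn_trans hT.2 h3o) (conn_symm h1o))
  rw [h, prob_empty]

omit [LinearOrder R] in
/-- The bare versions (`X = univ`) of the collapse lemmas, packaged for `Gc_update_one_eq_zero`. -/
lemma bare_collapse (p : E → R) (hends : ends e = s(a₃, o)) (a₁ a₂ : V) :
    prob (Function.update p e 1) (PDEvent ends a₁ a₂ a₃ ∩ connEvent ends a₁ o) = 0 ∧
    prob (Function.update p e 1) (PDEvent ends a₁ a₂ a₃ ∩ connEvent ends a₂ o) = 0 ∧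
    prob (Function.update p e 1) (avoidAll ends a₂ {a₁} ∩ connEvent ends a₁ o) =
      prob (Function.update p e 1) (TEvent ends a₂ a₁ a₃) ∧
    prob (Function.update p e 1) (avoidAll ends a₂ {a₁} ∩ connEvent ends a₂ o) =
      prob (Function.update p e 1) (TEvent ends a₁ a₂ a₃) ∧
    prob (Function.update p e 1) (TEvent ends a₂ a₁ a₃ ∩ connEvent ends a₁ o) =
      prob (Function.update p e 1) (TEvent ends a₂ a₁ a₃) ∧
    prob (Function.update p e 1) (TEvent ends a₂ a₁ a₃ ∩ connEvent ends a₂ o) = 0 ∧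
    prob (Function.update p e 1) (TEvent ends a₁ a₂ a₃ ∩ connEvent ends a₂ o) =
      prob (Function.update p e 1) (TEvent ends a₁ a₂ a₃) ∧
    prob (Function.update p e 1) (TEvent ends a₁ a₂ a₃ ∩ connEvent ends a₁ o) = 0 := by
  refine ⟨?_, ?_, ?_, ?_, ?_, ?_, ?_, ?_⟩
  · simpa only [Set.inter_univ] using prob_one_PD_oL_inter p hends a₁ a₂ Set.univ
  · simpa only [Set.inter_univ] using prob_one_PD_oH_inter p hends a₁ a₂ Set.univ
  · simpa only [Set.inter_univ] using prob_one_Q_oL_inter p hends a₁ a₂ Set.univ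
  · simpa only [Set.inter_univ] using prob_one_Q_oH_inter p hends a₁ a₂ Set.univ
  · simpa only [Set.inter_univ] using prob_one_T'_oL_inter p hends a₁ a₂ Set.univ
  · simpa only [Set.inter_univ] using prob_one_T'_oH_inter p hends a₁ a₂ Set.univ
  · simpa only [Set.inter_univ] using prob_one_T_oH_inter p hends a₁ a₂ Set.univ
  · simpa only [Set.inter_univ] using prob_one_T_oL_inter p hends a₁ a₂ Set.univ

omit [LinearOrder R] in
/-- **`Gc` vanishes at `p[e↦1]` for an edge `e = {a₃, o}`** (`a₃ ≡ o`: every `σ_o`-moment is the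
`σ₃`-moment and the `PD ∩ {o ∈ U}` masses are null — the edge form of `Gc_a3_eq_o`). -/
theorem Gc_update_one_eq_zero (p : E → R) (hends : ends e = s(a₃, o)) (a₁ a₂ b : V) :
    Gc (Function.update p e 1) ends o a₁ a₂ a₃ b = 0 := by
  obtain ⟨h1, h2, h3, h4, h5, h6, h7, h8⟩ := bare_collapse p hends a₁ a₂
  unfold Gc DEF EQbo EQb3 EQb3o EQo EQ3 EQ3o PDb PDbo Do
  simp only [prob_one_PD_oL_inter p hends a₁ a₂, prob_one_PD_oH_inter p hends a₁ a₂,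
    prob_one_Q_oL_inter p hends a₁ a₂, prob_one_Q_oH_inter p hends a₁ a₂,
    prob_one_T'_oL_inter p hends a₁ a₂, prob_one_T'_oH_inter p hends a₁ a₂,
    prob_one_T_oH_inter p hends a₁ a₂, prob_one_T_oL_inter p hends a₁ a₂, h1, h2, h3, h4, h5, h6,
    h7, h8]
  ring

end Pinned

section Closure

variable {V : Type*} {E : Type*} [Fintype E] [DecidableEq E] {R : Type*} [Field R] [LinearOrder R]
  [IsStrictOrderedRing R]

/-- **The o-edge closure from the two Bernstein coefficients**: for `e = {a₃, o}`, (HCOV) at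
`p[e↦0]` with `0 ≤ B1` and `0 ≤ B2` gives (HCOV) at `p` (no hypothesis at `p[e↦1]`, where `Gc = 0`).
The two hypotheses are the t-free inequalities `P1 ≥ 0`, `P2 ≥ 0` of P5-OEDGE.md §2. -/
theorem HCov_of_update_zero_of_bern_o (p : E → R) (hp : IsProbVec p) (ends : E → Sym2 V)
    (o a₁ a₂ a₃ b : V) (e : E) (hends : ends e = s(a₃, o))
    (h₀ : HCov (Function.update p e 0) ends o a₁ a₂ a₃ b) (hB1 : 0 ≤ B1 p ends o a₁ a₂ a₃ b e)
    (hB2 : 0 ≤ B2 p ends o a₁ a₂ a₃ b e) : HCov p ends o a₁ a₂ a₃ b :=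
  HCov_of_update_zero_of_bern p hp ends o a₁ a₂ a₃ b e h₀
    (by unfold HCov; rw [Gc_update_one_eq_zero p hends a₁ a₂ b])
    hB1 hB2

/-- The same for the orientation `e = {o, a₃}`. -/
theorem HCov_of_update_zero_of_bern_o' (p : E → R) (hp : IsProbVec p) (ends : E → Sym2 V)
    (o a₁ a₂ a₃ b : V) (e : E) (hends : ends e = s(o, a₃))
    (h₀ : HCov (Function.update p e 0) ends o a₁ a₂ a₃ b) (hB1 : 0 ≤ B1 p ends o a₁ a₂ a₃ b e)
    (hB2 : 0 ≤ B2 p ends o a₁ a₂ a₃ b e) : HCov p ends o a₁ a₂ a₃ b :=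
  HCov_of_update_zero_of_bern_o p hp ends o a₁ a₂ a₃ b e (by rw [hends, Sym2.eq_swap]) h₀ hB1 hB2

end Closure

end OEdge

end CovForm

end Summit.Ventures.PercRepro2
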